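import Mathlib
import HarnessLib
import Summits.HubbardSuperconductivity.HubbardSuperconductivity.Theorems.KLProgrammeKLRegimeTwoVolumeLipRowUnits
import Summits.HubbardSuperconductivity.HubbardSuperconductivity.Theorems.KLProgrammeKLRegimeTwoVolumeLipRemeasureBase1

/-!
# Route `KLProgramme` — crux K3 ENGINE (stmt-HubbardSuperconductivity-20437 `KLRegimeEngineV17F2`), stub (e) proof-input «(e)-D-ROWS», F-D7c RE-BASED AT BLOCK 1:
# THE (Dμ) ROW IN TRACK-`0` FLOOR UNITS WITH ONE BASE DATUM
# (seat hubbard-kl-k3c4-p1 g25, VL lane; `--supports` 20437; DROWS-SCOPE-g25 §13.2 resolved; composes `…TwoVolumeLipRemeasureBase1` (p726149) and the arithmetic of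
#  `…TwoVolumeLipRowUnits` (p724775))

As `…TwoVolumeLipRowUnits.lipDiffArray_row_le`, over the re-based row `klLipInputDiffSup_le_remeasured_base1`: the measured difference of block `k ≥ 2` in floor
units is at most the main terms `Σ_{k″∈[0,k]} (2ZC_J²)^m((32/2^m)^d)^{k+1−k″}·db k″`, PLUS the BASE term `C_J^{2m}·((32/2^m)^d)^{k−1}·(32Z^m·dE_1 m)` — the
block-1 measured difference array, the ONE two-volume UV datum of the difference tower (`EngineV8.towerDiff_le_of_geomBudget_base`'s `a₁χ^{k−1}·dμ 1`, after
`32Z^m·dE_1 ≤ dμ 1`) — PLUS the row source (far parts and coarse one-volume profiles).  No block-`0` born term, no `𝒱⁽⁰⁾` base.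

* `jumpCoeffBase_le` — `c^{2m}·klLevUnitF(m, d−1)/klLevUnitF(m, dk−1) ≤ C_J^{2m}·((32/2^m)^d)^{k−1}` for `c ≤ C_J·2^{dk−1−(d−1)}`;
* `row_units_base_le` — the bookkeeping over `[1,k)` with a base piece;
* **`lipDiffArray_row_le_base1`** — the displayed row at the model.

Compositions of landed theorems and real algebra; nothing asserts the (D) rows, stub (e), VL, K3 or superconductivity.
References: BGM 2006 §2.7 (2.71), §2.8 (2.93)–(2.98), §3 [cite: BenfattoGiulianiMastropietro2006].
-/

noncomputable section

namespace Summit.HubbardSuperconductivity.HubbardSuperconductivity.Theorems.TwoVolumeLip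

set_option linter.dupNamespace false -- summit = problem name (single-conjunct summit), D-0017

open Finset Literature.MathematicalPhysics.QuantumLattice GrassmannAlgebra Literature.Probability.LatticeModels
open Literature.MathematicalPhysics.QuantumLattice.FermiRG
open Summit.HubbardSuperconductivity.HubbardSuperconductivity.Theorems.KLRegimeSplit
open Summit.HubbardSuperconductivity.HubbardSuperconductivity.Theorems.KLProgrammeLegKernels
open Summit.HubbardSuperconductivity.HubbardSuperconductivity.Theorems.DispersionFlow
open Summit.HubbardSuperconductivity.HubbardSuperconductivity.Theorems.EngineV8
open Summit.HubbardSuperconductivity.HubbardSuperconductivity.Theorems.TwoVolumeSource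
open Summit.HubbardSuperconductivity.HubbardSuperconductivity.Theorems.TwoVolumeDefect

/-! ## §1 The base summand's coefficient and the bookkeeping -/

/-- **The base-jump coefficient in floor units** (`1 ≤ d`, `1 ≤ k`): if the rows of the base jump `klJump (bL) (dk−1) (d−1)` obey `c ≤ C_J·2^{dk−1−(d−1)}`, then
`c^{2m}·klLevUnitF β M 0 m (d−1)/klLevUnitF β M 0 m (dk−1) ≤ C_J^{2m}·((32/2^m)^d)^{k−1}`. -/
theorem jumpCoeffBase_le {β : ℝ} (hβ : 0 < β) {M : ℕ} [NeZero M] {d k m : ℕ} (hd : 1 ≤ d) (hk : 1 ≤ k)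
    {CJ c : ℝ} (hc0 : 0 ≤ c) (hc : c ≤ CJ * (2 : ℝ) ^ (d * k - 1 - (d * 1 - 1))) :
    c ^ (2 * m) * (klLevUnitF β M 0 m (d * 1 - 1) / klLevUnitF β M 0 m (d * k - 1)) ≤ CJ ^ (2 * m) * (((32 : ℝ) / 2 ^ m) ^ d) ^ (k - 1) := by
  set N : ℕ := d * k - 1 - (d * 1 - 1) with hN
  have hkk : d * 1 ≤ d * k := Nat.mul_le_mul_left d hk
  have hJ : d * k - 1 = (d * 1 - 1) + N := by omega
  have hsub : d * (k - 1) + d * 1 = d * k := by rw [← Nat.mul_add, Nat.sub_add_cancel hk]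
  have hN1 : N = d * (k - 1) := by omega
  have hratio : klLevUnitF β M 0 m (d * 1 - 1) / klLevUnitF β M 0 m (d * k - 1) = ((32 : ℝ) / 8 ^ m) ^ N := by
    have hU0 : klLevUnitF β M 0 m (d * 1 - 1) ≠ 0 := (klLevUnitF_pos hβ 0 m _).ne'
    rw [hJ, klLevUnitF_add, ← div_div, div_self hU0, one_div, ← inv_pow]
    unfold klLevRatioF
    rw [show klLevGain 0 = 0 from rfl, pow_zero, mul_one, inv_div]
  have hcpow : c ^ (2 * m) ≤ CJ ^ (2 * m) * ((4 : ℝ) ^ m) ^ N := by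
    calc c ^ (2 * m) ≤ (CJ * (2 : ℝ) ^ N) ^ (2 * m) := pow_le_pow_left₀ hc0 hc _
      _ = CJ ^ (2 * m) * ((4 : ℝ) ^ m) ^ N := by
          rw [mul_pow, ← pow_mul, ← pow_mul, show (4 : ℝ) = 2 ^ 2 by norm_num, ← pow_mul]
          congr 2; ring
  have hcomb : ((4 : ℝ) ^ m) ^ N * ((32 : ℝ) / 8 ^ m) ^ N = ((32 : ℝ) / 2 ^ m) ^ N := by
    rw [← mul_pow]
    congr 1
    have h8 : (8 : ℝ) ^ m = 4 ^ m * 2 ^ m := by rw [← mul_pow]; norm_num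
    rw [h8]
    have h2 : (2 : ℝ) ^ m ≠ 0 := by positivity
    have h4 : (4 : ℝ) ^ m ≠ 0 := by positivity
    field_simp
  have hCJ0 : 0 ≤ CJ ^ (2 * m) := by rw [pow_mul]; positivity
  rw [hratio]
  calc c ^ (2 * m) * ((32 : ℝ) / 8 ^ m) ^ N ≤ (CJ ^ (2 * m) * ((4 : ℝ) ^ m) ^ N) * ((32 : ℝ) / 8 ^ m) ^ N := by gcongr
    _ = CJ ^ (2 * m) * (((4 : ℝ) ^ m) ^ N * ((32 : ℝ) / 8 ^ m) ^ N) := by ring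
    _ = CJ ^ (2 * m) * (((32 : ℝ) / 2 ^ m) ^ d) ^ (k - 1) := by rw [hcomb, hN1, ← pow_mul]

/-- **Row bookkeeping, re-based at block 1** (pure algebra over `[1,k)`): if `S ≤ (P₁ + Q₁) + Σ_{k′∈[1,k)} (P k′ + Q k′)`, for `1 ≤ k′ < k` the main piece obeys
`c·P k′/U ≤ a·χ^{k−k′}·db (k′+1)` (`db ≥ 0`, `a, χ ≥ 0`) and the base piece `c·P₁/U ≤ a₁·χ^{k−1}·e₁` , then
`c·S/U ≤ Σ_{k″∈[0,k]} a·χ^{k+1−k″}·db k″ + a₁·χ^{k−1}·e₁ + c·(Q₁ + Σ_{k′∈[1,k)} Q k′)/U`. -/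
theorem row_units_base_le {k : ℕ} {S P₁ Q₁ e₁ a₁ c U a χ : ℝ} {P Q db : ℕ → ℝ}
    (hc : 0 ≤ c) (hU : 0 < U) (ha : 0 ≤ a) (hχ : 0 ≤ χ) (hdb0 : ∀ k'', 0 ≤ db k'')
    (hS : S ≤ (P₁ + Q₁) + ∑ k' ∈ Ico 1 k, (P k' + Q k'))
    (hmain : ∀ k', 1 ≤ k' → k' < k → c * P k' / U ≤ a * χ ^ (k - k') * db (k' + 1))
    (hbase : c * P₁ / U ≤ a₁ * χ ^ (k - 1) * e₁) :
    c * S / U ≤ (∑ k'' ∈ range (k + 1), a * χ ^ (k + 1 - k'') * db k'') + a₁ * χ ^ (k - 1) * e₁ + c * (Q₁ + ∑ k' ∈ Ico 1 k, Q k') / U := by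
  have hS' : c * S / U ≤ c * P₁ / U + c * (Q₁ + ∑ k' ∈ Ico 1 k, Q k') / U + ∑ k' ∈ Ico 1 k, c * P k' / U := by
    have h1 : c * S / U ≤ c * ((P₁ + Q₁) + ∑ k' ∈ Ico 1 k, (P k' + Q k')) / U :=
      div_le_div_of_nonneg_right (mul_le_mul_of_nonneg_left hS hc) hU.le
    refine h1.trans (le_of_eq ?_)
    rw [Finset.sum_add_distrib, ← Finset.sum_div, ← Finset.mul_sum]
    field_simp
    ring
  have hmain' : ∑ k' ∈ Ico 1 k, c * P k' / U ≤ ∑ k' ∈ Ico 1 k, a * χ ^ (k - k') * db (k' + 1) :=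
    Finset.sum_le_sum fun k' hk' => by
      obtain ⟨h1, h2⟩ := Finset.mem_Ico.1 hk'
      exact hmain k' h1 h2
  have hreidx : ∑ k' ∈ Ico 1 k, a * χ ^ (k - k') * db (k' + 1) = ∑ k'' ∈ Ico 2 (k + 1), a * χ ^ (k + 1 - k'') * db k'' := by
    rw [← Finset.sum_Ico_add' (fun k'' => a * χ ^ (k + 1 - k'') * db k'') 1 k 1]
    refine Finset.sum_congr rfl fun k' _ => ?_
    rw [show k + 1 - (k' + 1) = k - k' by omega]
  have hsub : ∑ k'' ∈ Ico 2 (k + 1), a * χ ^ (k + 1 - k'') * db k'' ≤ ∑ k'' ∈ range (k + 1), a * χ ^ (k + 1 - k'') * db k'' := by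
    refine Finset.sum_le_sum_of_subset_of_nonneg (fun x hx => ?_) (fun k'' _ _ => by have := hdb0 k''; positivity)
    rw [Finset.mem_Ico] at hx; rw [Finset.mem_range]; omega
  linarith [hS', hmain', hreidx.le, hreidx.ge, hsub, hbase]

section ModelBase1

variable {L b M : ℕ} [NeZero L] [NeZero (b * L)] [NeZero M]

set_option maxHeartbeats 800000 in -- large statement
/-- **THE (Dμ) ROW IN FLOOR UNITS, RE-BASED AT BLOCK 1** (block `k ≥ 2`, `2 ≤ d`, degree `n + 1 = 2m`, depth `D₀ + r`, `2r ≤ D₀`, `R_in(1) ≤ D₀`): as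
`lipDiffArray_row_le` but over `klLipInputDiffSup_le_remeasured_base1`: the main terms `Σ_{k″∈[0,k]} (2ZC_J²)^m((32/2^m)^d)^{k+1−k″}·db k″`, the BASE term
`C_J^{2m}·((32/2^m)^d)^{k−1}·(32·Z^m·klLipInputDiffSup … d 1 (n+1) (R_in 1)/(ε·klLevUnitF β M 0 m (d−1)))` (rows of the base jump `≤ C_J·2^{dk−1−(d−1)}`), and the ROW
SOURCE (far parts and coarse profiles of the base input and of the born terms `1 ≤ k′ < k`). -/
theorem lipDiffArray_row_le_base1 {β : ℝ} (hβ : 0 < β) (U μ : ℝ) (K : TrigPolyC4v) {d : ℕ} (hd : 2 ≤ d) {k : ℕ} (hk : 2 ≤ k)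
    {n m : ℕ} (hq : 2 * m = n + 1) (D₀ r jr : ℕ) (hD₀ : 2 * r ≤ D₀)
    {ΛT : ℝ} {cW : ℕ → ℝ} {cW₁ : ℝ} (hΛT : 0 ≤ ΛT) (hΛr : ΛT ≤ klScale klE0 jr) (hcW : ∀ k', 0 ≤ cW k') (hcW₁ : 0 ≤ cW₁)
    (hrow : ∀ k' ∈ Ico 1 k, ∀ x, ∑ y', ‖klJump (b * L) M β μ K (d * k - 1) (d * k') x y'‖ *
      klScaleWt (b * L) M β jr {latticeLegPos (2 * (2 * M)) x, latticeLegPos (2 * (2 * M)) y'} ≤ cW k')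
    (hcol : ∀ k' ∈ Ico 1 k, ∀ y', ∑ x, ‖klJump (b * L) M β μ K (d * k - 1) (d * k') x y'‖ *
      klScaleWt (b * L) M β jr {latticeLegPos (2 * (2 * M)) x, latticeLegPos (2 * (2 * M)) y'} ≤ cW k')
    (hrow₁ : ∀ x, ∑ y', ‖klJump (b * L) M β μ K (d * k - 1) (d * 1 - 1) x y'‖ *
      klScaleWt (b * L) M β jr {latticeLegPos (2 * (2 * M)) x, latticeLegPos (2 * (2 * M)) y'} ≤ cW₁)
    (hcol₁ : ∀ y', ∑ x, ‖klJump (b * L) M β μ K (d * k - 1) (d * 1 - 1) x y'‖ *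
      klScaleWt (b * L) M β jr {latticeLegPos (2 * (2 * M)) x, latticeLegPos (2 * (2 * M)) y'} ≤ cW₁)
    {CJ : ℝ} (hcWenv : ∀ k', 1 ≤ k' → k' < k → cW k' ≤ CJ * (2 : ℝ) ^ (d * k - 1 - d * k'))
    (hcW₁env : cW₁ ≤ CJ * (2 : ℝ) ^ (d * k - 1 - (d * 1 - 1)))
    {NI NIfar : ℝ} (hNI0 : 0 ≤ NI) (hNIfar0 : 0 ≤ NIfar)
    (hNI : ∀ (q : Fin (n + 1)) y, ∑ Y ∈ univ.filter (fun Y : Fin (n + 1) → SpaceTimeIdx L M × SectorLeg (sectorCount (d * 1 - 1)) => Y q = y),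
      ‖kernel ℂ (klLipInput L M β U μ K d 1) (n + 1) Y‖ ≤ NI)
    (hNIfar : ∀ (q : Fin (n + 1)) y (i : Fin (n + 1)),
      ∑ Y ∈ univ.filter (fun Y : Fin (n + 1) → SpaceTimeIdx L M × SectorLeg (sectorCount (d * 1 - 1)) => Y q = y ∧ r < Torus.tnorm ((Y q).1.2 - (Y i).1.2)),
        ‖kernel ℂ (klLipInput L M β U μ K d 1) (n + 1) Y‖ ≤ NIfar)
    {N Nfar : ℕ → ℝ} (hN0 : ∀ k', 0 ≤ N k') (hNfar0 : ∀ k', 0 ≤ Nfar k')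
    (hN : ∀ k' ∈ Ico 1 k, ∀ (q : Fin (n + 1)) (y : SpaceTimeIdx L M × SectorLeg (sectorCount (d * k'))),
      ∑ Y ∈ univ.filter (fun Y : Fin (n + 1) → SpaceTimeIdx L M × SectorLeg (sectorCount (d * k')) => Y q = y),
        ‖kernel ℂ (klLipBorn L M β U μ K d k') (n + 1) Y‖ ≤ N k')
    (hNfar : ∀ k' ∈ Ico 1 k, ∀ (q : Fin (n + 1)) (y : SpaceTimeIdx L M × SectorLeg (sectorCount (d * k'))) (i : Fin (n + 1)),
      ∑ Y ∈ univ.filter (fun Y : Fin (n + 1) → SpaceTimeIdx L M × SectorLeg (sectorCount (d * k')) =>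
          Y q = y ∧ r < Torus.tnorm ((Y q).1.2 - (Y i).1.2)), ‖kernel ℂ (klLipBorn L M β U μ K d k') (n + 1) Y‖ ≤ Nfar k')
    (Rout : ℕ → ℕ) (hdepth : ∀ k', 1 ≤ k' → k' < k → Rout k' ≤ D₀) (Rin₁ : ℕ) (hRin₁ : Rin₁ ≤ D₀)
    (db : ℕ → ℝ) (hdb0 : ∀ k'', 0 ≤ db k'')
    (hdb : ∀ k', 1 ≤ k' → k' < k →
      klLipBornDiffSup L b M β U μ K d k' (n + 1) (Rout k') ≤ db (k' + 1) * (imagTimeWeight β M * klLevUnitF β M 0 m (d * k')))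
    {Z : ℝ} (hZ : 0 ≤ Z) :
    32 * Z ^ m * klLipInputDiffSup L b M β U μ K d k (n + 1) (D₀ + r) / (imagTimeWeight β M * klLevUnitF β M 0 m (d * k - 1)) ≤
      (∑ k'' ∈ range (k + 1), (2 * Z * CJ ^ 2) ^ m * (((32 : ℝ) / 2 ^ m) ^ d) ^ (k + 1 - k'') * db k'') +
        CJ ^ (2 * m) * (((32 : ℝ) / 2 ^ m) ^ d) ^ (k - 1) *
          (32 * Z ^ m * klLipInputDiffSup L b M β U μ K d 1 (n + 1) Rin₁ / (imagTimeWeight β M * klLevUnitF β M 0 m (d * 1 - 1))) +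
        32 * Z ^ m * ((cW₁ ^ n * (cW₁ / (1 + ΛT * ((r : ℝ) + 1)) * klLipInputDiffSup L b M β U μ K d 1 (n + 1) 0) +
            (2 * cW₁ ^ n * (cW₁ / (1 + ΛT * ((r : ℝ) + 1))) * NI + n * cW₁ ^ n * (5 * (cW₁ / (1 + ΛT * ((r : ℝ) + 1))) * NI + 2 * cW₁ * NIfar))) +
          ∑ k' ∈ Ico 1 k, (cW k' ^ n * (cW k' / (1 + ΛT * ((r : ℝ) + 1)) * klLipBornDiffSup L b M β U μ K d k' (n + 1) 0) +
            (2 * cW k' ^ n * (cW k' / (1 + ΛT * ((r : ℝ) + 1))) * N k' +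
              n * cW k' ^ n * (5 * (cW k' / (1 + ΛT * ((r : ℝ) + 1))) * N k' + 2 * cW k' * Nfar k')))) /
          (imagTimeWeight β M * klLevUnitF β M 0 m (d * k - 1)) := by
  have hx : 0 < imagTimeWeight β M := imagTimeWeight_pos_of_pos (M := M) hβ
  have hU : 0 < imagTimeWeight β M * klLevUnitF β M 0 m (d * k - 1) := mul_pos hx (klLevUnitF_pos hβ 0 m _)
  have hU₁ : 0 < imagTimeWeight β M * klLevUnitF β M 0 m (d * 1 - 1) := mul_pos hx (klLevUnitF_pos hβ 0 m _)
  have hd1 : 1 ≤ d := by omega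
  have hk1 : 1 ≤ k := by omega
  -- the row in absolute units, summands split into MAIN + REST
  set P : ℕ → ℝ := fun k' => cW k' ^ n * (cW k' * klLipBornDiffSup L b M β U μ K d k' (n + 1) D₀) with hP
  set Q : ℕ → ℝ := fun k' => cW k' ^ n * (cW k' / (1 + ΛT * ((r : ℝ) + 1)) * klLipBornDiffSup L b M β U μ K d k' (n + 1) 0) +
    (2 * cW k' ^ n * (cW k' / (1 + ΛT * ((r : ℝ) + 1))) * N k' +
      n * cW k' ^ n * (5 * (cW k' / (1 + ΛT * ((r : ℝ) + 1))) * N k' + 2 * cW k' * Nfar k')) with hQ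
  set P₁ : ℝ := cW₁ ^ n * (cW₁ * klLipInputDiffSup L b M β U μ K d 1 (n + 1) D₀) with hP₁
  set Q₁ : ℝ := cW₁ ^ n * (cW₁ / (1 + ΛT * ((r : ℝ) + 1)) * klLipInputDiffSup L b M β U μ K d 1 (n + 1) 0) +
    (2 * cW₁ ^ n * (cW₁ / (1 + ΛT * ((r : ℝ) + 1))) * NI + n * cW₁ ^ n * (5 * (cW₁ / (1 + ΛT * ((r : ℝ) + 1))) * NI + 2 * cW₁ * NIfar)) with hQ₁
  have hS := klLipInputDiffSup_le_remeasured_base1 (L := L) (b := b) (M := M) hβ U μ K hd hk n D₀ r jr hD₀ hΛT hΛr hcW hcW₁ hrow hcol hrow₁ hcol₁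
    hNI0 hNIfar0 hNI hNIfar hN0 hNfar0 hN hNfar
  have hS' : klLipInputDiffSup L b M β U μ K d k (n + 1) (D₀ + r) ≤ (P₁ + Q₁) + ∑ k' ∈ Ico 1 k, (P k' + Q k') := by
    refine hS.trans (le_of_eq ?_)
    congr 1
    · simp only [hP₁, hQ₁]; ring
    · refine Finset.sum_congr rfl fun k' _ => ?_
      simp only [hP, hQ]; ring
  -- the main pieces in units
  have hmain : ∀ k', 1 ≤ k' → k' < k → (32 * Z ^ m) * P k' / (imagTimeWeight β M * klLevUnitF β M 0 m (d * k - 1)) ≤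
      (2 * Z * CJ ^ 2) ^ m * (((32 : ℝ) / 2 ^ m) ^ d) ^ (k - k') * db (k' + 1) := by
    intro k' hk'1 hk'k
    have hc0 := hcW k'
    have hSb : klLipBornDiffSup L b M β U μ K d k' (n + 1) D₀ ≤ db (k' + 1) * (imagTimeWeight β M * klLevUnitF β M 0 m (d * k')) :=
      (klLipBornDiffSup_anti β U μ K d k' (n + 1) (hdepth k' hk'1 hk'k)).trans (hdb k' hk'1 hk'k)
    have hcoef := jumpCoeff_le (β := β) (M := M) (m := m) hβ hd1 hk'k hZ hc0 (hcWenv k' hk'1 hk'k)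
    have hpow : cW k' ^ n * cW k' = cW k' ^ (2 * m) := by rw [hq, pow_succ]
    calc (32 * Z ^ m) * P k' / (imagTimeWeight β M * klLevUnitF β M 0 m (d * k - 1))
        = (32 * Z ^ m * cW k' ^ (2 * m)) * klLipBornDiffSup L b M β U μ K d k' (n + 1) D₀ /
            (imagTimeWeight β M * klLevUnitF β M 0 m (d * k - 1)) := by
          simp only [hP]; rw [← hpow]; ring
      _ ≤ (32 * Z ^ m * cW k' ^ (2 * m)) * (db (k' + 1) * (imagTimeWeight β M * klLevUnitF β M 0 m (d * k'))) /
            (imagTimeWeight β M * klLevUnitF β M 0 m (d * k - 1)) := by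
          have h0 : 0 ≤ 32 * Z ^ m * cW k' ^ (2 * m) := by positivity
          exact div_le_div_of_nonneg_right (mul_le_mul_of_nonneg_left hSb h0) hU.le
      _ = (32 * Z ^ m * cW k' ^ (2 * m) * (klLevUnitF β M 0 m (d * k') / klLevUnitF β M 0 m (d * k - 1))) * db (k' + 1) := by
          field_simp
      _ ≤ ((2 * Z * CJ ^ 2) ^ m * (((32 : ℝ) / 2 ^ m) ^ d) ^ (k - k')) * db (k' + 1) :=
          mul_le_mul_of_nonneg_right hcoef (hdb0 _)
  -- the base piece in units (`d * 1 - 1` is `simp`-normalised to `d - 1`: provide the nonvanishing facts in that form too)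
  have hID0 : ∀ R, 0 ≤ klLipInputDiffSup L b M β U μ K d 1 (n + 1) R := fun R => klLipInputDiffSup_nonneg β U μ K d 1 (n + 1) R
  have hUd1 : klLevUnitF β M 0 m (d - 1) ≠ 0 := (klLevUnitF_pos hβ 0 m _).ne'
  have hU1ne : klLevUnitF β M 0 m (d * 1 - 1) ≠ 0 := (klLevUnitF_pos hβ 0 m _).ne'
  have hUdk : klLevUnitF β M 0 m (d * k - 1) ≠ 0 := (klLevUnitF_pos hβ 0 m _).ne'
  have hxne : imagTimeWeight β M ≠ 0 := hx.ne'
  have hbase : (32 * Z ^ m) * P₁ / (imagTimeWeight β M * klLevUnitF β M 0 m (d * k - 1)) ≤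
      CJ ^ (2 * m) * (((32 : ℝ) / 2 ^ m) ^ d) ^ (k - 1) *
        (32 * Z ^ m * klLipInputDiffSup L b M β U μ K d 1 (n + 1) Rin₁ / (imagTimeWeight β M * klLevUnitF β M 0 m (d * 1 - 1))) := by
    have hSb : klLipInputDiffSup L b M β U μ K d 1 (n + 1) D₀ ≤ klLipInputDiffSup L b M β U μ K d 1 (n + 1) Rin₁ :=
      klLipInputDiffSup_anti β U μ K d 1 (n + 1) hRin₁
    have hcoef := jumpCoeffBase_le (β := β) (M := M) (m := m) hβ hd1 hk1 hcW₁ hcW₁env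
    have hpow : cW₁ ^ n * cW₁ = cW₁ ^ (2 * m) := by rw [hq, pow_succ]
    have hset : klLipInputDiffSup L b M β U μ K d 1 (n + 1) Rin₁ =
        (klLipInputDiffSup L b M β U μ K d 1 (n + 1) Rin₁ / (imagTimeWeight β M * klLevUnitF β M 0 m (d * 1 - 1))) *
          (imagTimeWeight β M * klLevUnitF β M 0 m (d * 1 - 1)) := by rw [div_mul_cancel₀ _ hU₁.ne']
    calc (32 * Z ^ m) * P₁ / (imagTimeWeight β M * klLevUnitF β M 0 m (d * k - 1))
        = (32 * Z ^ m * cW₁ ^ (2 * m)) * klLipInputDiffSup L b M β U μ K d 1 (n + 1) D₀ /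
            (imagTimeWeight β M * klLevUnitF β M 0 m (d * k - 1)) := by
          simp only [hP₁]; rw [← hpow]; ring
      _ ≤ (32 * Z ^ m * cW₁ ^ (2 * m)) * klLipInputDiffSup L b M β U μ K d 1 (n + 1) Rin₁ /
            (imagTimeWeight β M * klLevUnitF β M 0 m (d * k - 1)) := by
          have h0 : 0 ≤ 32 * Z ^ m * cW₁ ^ (2 * m) := by positivity
          exact div_le_div_of_nonneg_right (mul_le_mul_of_nonneg_left hSb h0) hU.le
      _ = (cW₁ ^ (2 * m) * (klLevUnitF β M 0 m (d * 1 - 1) / klLevUnitF β M 0 m (d * k - 1))) *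
            (32 * Z ^ m * klLipInputDiffSup L b M β U μ K d 1 (n + 1) Rin₁ / (imagTimeWeight β M * klLevUnitF β M 0 m (d * 1 - 1))) := by
          field_simp
      _ ≤ (CJ ^ (2 * m) * (((32 : ℝ) / 2 ^ m) ^ d) ^ (k - 1)) *
            (32 * Z ^ m * klLipInputDiffSup L b M β U μ K d 1 (n + 1) Rin₁ / (imagTimeWeight β M * klLevUnitF β M 0 m (d * 1 - 1))) :=
          mul_le_mul_of_nonneg_right hcoef (by have := hID0 Rin₁; positivity)
  have hχ : (0 : ℝ) ≤ ((32 : ℝ) / 2 ^ m) ^ d := by positivity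
  have ha : (0 : ℝ) ≤ (2 * Z * CJ ^ 2) ^ m := by positivity
  have h := row_units_base_le (S := klLipInputDiffSup L b M β U μ K d k (n + 1) (D₀ + r)) (c := 32 * Z ^ m) (by positivity) hU ha hχ hdb0 hS' hmain hbase
  refine (le_of_eq ?_).trans (h.trans (le_of_eq ?_))
  · ring
  · simp only [hQ, hQ₁]

end ModelBase1

end Summit.HubbardSuperconductivity.HubbardSuperconductivity.Theorems.TwoVolumeLip

end
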